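import Summits.BirchSwinnertonDyer.BirchSwinnertonDyer.Theorems.GenusKolyvaginAtTwoMinimalTwinBSDTwoSwappedPairDescent
import Summits.BirchSwinnertonDyer.BirchSwinnertonDyer.Theses.GenusKolyvaginAtTwo
import HarnessLib

/-!
# Route `GenusKolyvaginAtTwo`, crux U₂ `MinimalTwinBSDTwo` (stmt-BirchSwinnertonDyer-22985), LINE 23 «twin_swap» v1.2:
# THE `2`-PRIMITIVITY CLAUSE `P(1) ∉ 2E(K[1])` OF STUB S2′ IS THE ODDNESS OF THE HEEGNER INDEX (unconditional reading),
# AND OFF THE ODD-TAMAGAWA SLICE IT IS BSD-INCONSISTENT (`2 ∣ C(E)` forces `2 ∣ y_K`)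

Seat `bsd-line-gk2-p3` g28 (PROVER seat 3/3, cell `bsd-f1-sign2`), `--supports stmt-BirchSwinnertonDyer-22985` (helper; closes nothing).
THEOREMS ONLY (no definition, no named fact, no `sorry`); standard axioms.  **BSD is NOT proved by this file; U₂ / hTw / S2′ are NOT
proved; no item is closed.**  §1–§2 are UNCONDITIONAL; §3 is CONDITIONAL on `BSD₂` of the pair (resp. on the leaf `Rank1Residual.NonCMAtTwo`,
what the route wants to prove) and on the route's four PRINT items `GrossZagierAllLevels` (24148), `EntireLFunctionRat` (19273),
`MultPublishedInputsAtTwo` (19921), `MilneAnyModel` (24149) — census certificates, not progress on BSD.  Companion files (same seat / gk2-p2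
g23): `…SwappedPairLossless` (g23: on the ODD slice the two `BSD₂` force the clause), `…SwappedPairLosslessOfLeaf` (this seat: the same from
the leaf, census shape S2″ ⟹ S2′), `…MinimalTwinBSDTwoTamagawaSlices` (this seat: the route consumes U₂ on exactly two Tamagawa cells).

THE FRAME («swapped pair», LINE 23; LEAD word 2026-08-30T07:17Z, gk2-p2 g23 memo `Cruxes/MinimalTwinBSDTwo/Lines/twin-swap-s3prime-gk2p2.md`).
`W/ℚ` globally minimal with `#Sel₂(E) = 2`; `K` imaginary quadratic, `d_K` odd, Heegner for `N_E`; a datum `Dt`, `(β, ι)`, a conductor-`1`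
Kolyvagin–Heegner datum `d₁` with `P(1) = y_K` of infinite order; an elliptic `ℚ`-model `Wd ≅ E^(d_K)` with `#Sel₂(Wd) = 1`.  Stub S2′
(`ReversedMinimalSupplyAtTwoDepthZero`, v1.2) asks such a frame to EXIST (with `d_K ≠ −3`, `Dt.c` odd, `Wd` globally minimal inside the
genus budget, `C(E)` odd) together with the clause **`P(1) ∉ 2E(K[1])`**.  This file reads that clause:

* §1 `swappedFrame` — bookkeeping on the frame, UNCONDITIONAL: `P(1)` descends to `P₀ ∈ E(K)` of infinite order, `rank E(ℚ) = 1`,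
  `rank E(K) = 1`, `E(ℚ)[2] = E(K)[2] = 0`, `E(K[1])[2^M] = 0` (gk2-p2 g23's frame lemmas p764643/p764815 re-assembled).
* §2 **`not_twoDiv_derivedPoint_iff_padicValNat_index_eq_zero`**, **`not_twoDiv_derivedPoint_iff_not_two_dvd_index`** (UNCONDITIONAL) —
  on the frame, for the Heegner point `P₀ ∈ E(K)` below `P(1)`: **`P(1) ∉ 2E(K[1]) ↔ ord₂ [E(K) : ℤP₀] = 0 ↔ ¬ 2 ∣ [E(K) : ℤP₀]`**
  (McCallum's Lemma 5.1 at `p = 2`, `M₀ = 0`: Galois descent `K[1] → K` + a rank-one coordinate; `E(K)_tors` has odd order).  So the clause IS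
  «the Heegner index `[E(K) : ℤy_K]` is odd» — exactly the quantity the pen's instrument REVFALS-g23 computes (odd on 41/41 odd-Tamagawa cells,
  `N ≤ 250`).
* §3 **`twoDiv_derivedPoint_of_bsdp_of_two_dvd_tamagawa`** / `…_of_nonCMAtTwo_of_two_dvd_tamagawa` — THE OTHER SIDE OF THE SLICE: with
  **`2 ∣ C(E)`** (no budget, no parity input), `d_K ≠ −3`, `Dt.c` odd, `Wd` globally minimal: `BSD₂(E) ∧ BSD₂(Wd)` + PRINT (resp. the LEAF +
  PRINT) FORCE **`P(1) ∈ 2E(K[1])`**.  Mechanism: fkl g7's exactness-on-the-canonical-model iff `AdditivePotMult.missingPPartOverCAt_baseChange_iff_bsdp`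
  (`.mpr`) turns the two `BSD₂` into `ord₂ #Ш_an(E_K) = ord₂ #Ш(E_K) ≥ 0`; Gross–Zagier over `K` (`CMExactDescent.shaAnOverC_baseChange_eq_of_heegner`)
  reads `#Ш_an(E_K) = 4I²/(c² w_K² C(E)²)`, `w_K = 2`, `c` odd, so `ord₂ #Ш_an(E_K) = 2 ord₂ I − 2 ord₂ C(E)`; hence `ord₂ I ≥ ord₂ C(E) ≥ 1` and
  §2 (divisibility direction).  READING: LINE 23's confinement to odd `C(E)` is imposed BY BSD, not by the method — on the even-Tamagawa cell of
  U₂ that the route actually consumes (`Δ < 0`, `ord₂ C(Wd) = 1`; sibling file `…TamagawaSlices`) every reversed supply is POSITIVE-DEPTH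
  (`M₀ ≥ 1`), the `ε = −1` image of the supply cruxes' `K₄`-type cells; «S2′ without `Odd C(E)`» is refuted modulo the leaf at every
  even-`C(E)` frame.

References: [GrossZagier1986] I.(6.3), V.§2 (2.2); [GrossLMS1991] §2 (2.2), §4, §5 Prop. 5.3; [McCallumLMS1991] §5 Lemma 5.1;
[Milne1972ArithmeticAV] §1 Thm. 1; [Kramer1981] Thm. 1; [SilvermanAEC2009] VIII.6.7, X.4.2; [Miller2011LMS] Def. 1.1.
-/

set_option autoImplicit false
set_option linter.dupNamespace false -- `Summit.<P>.<Sub>` repeats `BirchSwinnertonDyer` (D-0017)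

noncomputable section

open scoped Classical

open WeierstrassCurve NumberField Literature.NumberTheory.EllipticCurves
  Literature.NumberTheory.EllipticCurves.ModularForms
  Literature.NumberTheory.EllipticCurves.Rank1Residual
  Literature.NumberTheory.EllipticCurves.Rank1Residual.Typed
  Literature.NumberTheory.EllipticCurves.KrizLi2019
  Summit.BirchSwinnertonDyer.Rank1Residual
  Summit.BirchSwinnertonDyer.Rank1Residual.AdditivePotMult
  Summit.BirchSwinnertonDyer.BirchSwinnertonDyer.Rank1Residual
  Summit.BirchSwinnertonDyer.BirchSwinnertonDyer.Theses.GenusKolyvaginAtTwo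
  Summit.BirchSwinnertonDyer.BirchSwinnertonDyer.Theorems.CMExactDescent

namespace Summit.BirchSwinnertonDyer.BirchSwinnertonDyer.Theorems.GenusExact.TwinSwap.HeegnerIndex

/-! ## §1 The swapped frame: descent of `P(1)`, ranks, no `2`-torsion (unconditional bookkeeping) -/

/-- **The swapped frame, bookkeeping.**  `W/ℚ` globally minimal with `#Sel₂(E) = 2`; `K` imaginary quadratic, `d_K` odd, Heegner for
`N_E`; a conductor-`1` datum `d₁` with `P(1)` of infinite order; an elliptic `Wd ≅ E^(d_K)` with `#Sel₂(Wd) = 1`; `P₀ ∈ E(K)` mapping to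
`P(1)`.  Then: `P₀` has infinite order, `rank E(ℚ) = 1`, `rank E(K) = 1`, `E(ℚ)[2] = 0`, `E(K)[2] = 0`, and `E(K[1])[2^M] = 0` for all `M`.
(`rank E^(d_K)(ℚ) = 0` from `#Sel₂ = 1`; `rank E(K) = rank E(ℚ) + rank E^(d_K)(ℚ)`; descent count `#Sel₂ = 2^rank · #E[2] · #Ш[2]`.)
[cite: SilvermanAEC2009, Thm. X.4.2] [cite: GrossLMS1991, §4 Lemma 4.3 (shape)] -/
theorem swappedFrame
    (W : WeierstrassCurve ℚ) [W.IsElliptic] [W.IsGloballyMinimal] [NeZero (W.conductorNorm ℤ)]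
    (K : Type) [Field K] [NumberField K] (hK : IsImaginaryQuadratic K) (hodd : Odd (NumberField.discr K))
    (hH : SatisfiesHeegnerHypothesis (W.conductorNorm ℤ) K) (hSel : Nat.card (W.selmerGroup 2) = 2)
    {Dt : ModularParametrizationData W (W.conductorNorm ℤ)} {β : ℤ} (ι : K →+* ℂ) (d₁ : KolyvaginHeegnerData Dt β ι 1)
    (hy : ¬ IsOfFinAddOrder d₁.derivedPoint)
    {Wd : WeierstrassCurve ℚ} [Wd.IsElliptic] (Cd : VariableChange ℚ) (hCd : Cd • W.quadraticTwist (NumberField.discr K : ℚ) = Wd)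
    (hSel1 : Nat.card (Wd.selmerGroup 2) = 1)
    (P₀ : (W.baseChange K).toAffine.Point)
    (hP₀K : WeierstrassCurve.Affine.Point.map (W' := W) (algebraMap K (ringClassField K ι 1)).toRatAlgHom P₀ = d₁.derivedPoint) :
    ¬ IsOfFinAddOrder P₀ ∧ W.mordellWeilRank = 1 ∧ (W.baseChange K).mordellWeilRank = 1 ∧
      (∀ P : W.toAffine.Point, 2 • P = 0 → P = 0) ∧
      (∀ x : (W.baseChange K).toAffine.Point, 2 • x = 0 → x = 0) ∧
      (∀ (M : ℕ) (R : (W.baseChange (ringClassField K ι 1)).toAffine.Point), ((2 ^ M : ℕ) : ℤ) • R = 0 → R = 0) := by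
  haveI : Fact (Nat.Prime 2) := ⟨Nat.prime_two⟩
  haveI hEK : (W.baseChange K).IsElliptic := isElliptic_baseChange' W K
  have h2 : Module.finrank ℚ K = 2 := hK.1
  have hD0 : (NumberField.discr K : ℚ) ≠ 0 := by exact_mod_cast NumberField.discr_ne_zero K
  haveI hEt : (W.quadraticTwist (NumberField.discr K : ℚ)).IsElliptic := W.isElliptic_quadraticTwist hD0
  -- `P₀` has infinite order (it maps to `P(1)`)
  have hPinf : ¬ IsOfFinAddOrder P₀ := by
    intro hfin
    apply hy
    rw [← hP₀K]
    exact (WeierstrassCurve.Affine.Point.map (W' := W)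
      (algebraMap K (ringClassField K ι 1)).toRatAlgHom).isOfFinAddOrder hfin
  -- ranks: `rank E(K) ≥ 1`, `rank E^(d_K)(ℚ) = 0`, so `rank E(ℚ) ≥ 1`, hence `= 1` and `rank E(K) = 1`
  haveI : Module.Finite ℤ (W.baseChange K).toAffine.Point := (W.baseChange K).module_finite_point_holds
  have hK1 : 1 ≤ (W.baseChange K).mordellWeilRank :=
    Literature.NumberTheory.EllipticCurves.one_le_mordellWeilRank_of_not_isOfFinAddOrder (W.baseChange K) inferInstance hPinf
  have hSelT : Nat.card ((W.quadraticTwist (NumberField.discr K : ℚ)).selmerGroup ((2 : ℕ) : ℤ)) = 1 := by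
    have h := natCard_selmerGroup_smul (W.quadraticTwist (NumberField.discr K : ℚ)) Cd (n := 2) two_ne_zero
    rw [hCd] at h
    rw [← h, Nat.cast_ofNat]
    exact hSel1
  obtain ⟨hrkT0, -, -⟩ := rank_eq_zero_and_torsionBy_eq_bot_and_sha_inf_torsionBy_eq_bot_of_natCard_selmerGroup_eq_one
    (W.quadraticTwist (NumberField.discr K : ℚ)) 2 hSelT
  have hsum := W.mordellWeilRank_baseChange_of_finrank_eq_two_of_finite K h2
  rw [hrkT0, add_zero] at hsum
  have hrk : 1 ≤ W.mordellWeilRank := by rw [← hsum]; exact hK1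
  obtain ⟨hrk1, hT2, -⟩ := rank_eq_one_and_sha_primary_eq_zero_of_natCard_selmerGroup_eq_two W hSel hrk
  have hrkK : (W.baseChange K).mordellWeilRank = 1 := by rw [hsum, hrk1]
  have hT2' : ∀ P : W.toAffine.Point, 2 • P = 0 → P = 0 := fun P hP ↦ by convert hT2 P (by convert hP)
  have htor1 : ∀ (M : ℕ) (R : (W.baseChange (ringClassField K ι 1)).toAffine.Point),
      ((2 ^ M : ℕ) : ℤ) • R = 0 → R = 0 :=
    fun M R hR ↦ eq_zero_of_two_pow_smul_eq_zero_ringClassField_of_noTwoTorsion W hK hodd hH hT2' ι M R hR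
  have hiv : ∀ x : (W.baseChange K).toAffine.Point, 2 • x = 0 → x = 0 := fun x hx ↦
    forall_two_zsmul_baseChange_eq_zero_of_heegner W K hK hodd hH hT2' x (by rw [← natCast_zsmul] at hx; exact_mod_cast hx)
  exact ⟨hPinf, hrk1, hrkK, hT2', hiv, htor1⟩

/-! ## §2 The clause `P(1) ∉ 2E(K[1])` is the oddness of the Heegner index (unconditional) -/

/-- **`P(1) ∉ 2E(K[1]) ↔ ord₂ [E(K) : ℤP₀] = 0`** on the swapped frame (UNCONDITIONAL; no print fact).  `W/ℚ` globally minimal with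
`#Sel₂(E) = 2`; `K` imaginary quadratic, `d_K` odd, Heegner for `N_E`; `d₁` conductor-`1` with `P(1)` of infinite order; an elliptic
`Wd ≅ E^(d_K)` with `#Sel₂(Wd) = 1`; `P₀ ∈ E(K)` the point below `P(1)`.  Then the `2`-primitivity of `P(1)` in `E(K[1])` (the clause of
LINE 23's stub S2′) holds iff the index `[E(K) : ℤP₀]` is ODD.  McCallum's Lemma 5.1 at `p = 2`, `M₀ = 0`: `2 ∣ P(1)` in `E(K[1])` iff
`2 ∣ P₀` in `E(K)` (Galois descent, `E(K[1])[2] = 0`, tree `X11b.Three.Koly.pDiv_one_iff_exists_zsmul_eq`) iff `2 ∣ c(P₀)` for a rank-one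
coordinate `c : E(K) → ℤ` (`E(K)_tors` is `2`-divisible, having odd order) iff `2 ∣ [E(K) : ℤP₀]` (`X11b.RankOne.padicValNat_index_zmultiples_eq`).
This is the quantity the instrument REVFALS-g23 reads («Heegner index odd»).
[cite: McCallumLMS1991, §5 Lemma 5.1 (p. 303)] [cite: GrossLMS1991, §4 (P_1 = y_K)] [cite: SilvermanAEC2009, Thm. VIII.6.7] -/
theorem not_twoDiv_derivedPoint_iff_padicValNat_index_eq_zero
    (W : WeierstrassCurve ℚ) [W.IsElliptic] [W.IsGloballyMinimal] [NeZero (W.conductorNorm ℤ)]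
    (K : Type) [Field K] [NumberField K] (hK : IsImaginaryQuadratic K) (hodd : Odd (NumberField.discr K))
    (hH : SatisfiesHeegnerHypothesis (W.conductorNorm ℤ) K) (hSel : Nat.card (W.selmerGroup 2) = 2)
    {Dt : ModularParametrizationData W (W.conductorNorm ℤ)} {β : ℤ} (ι : K →+* ℂ) (d₁ : KolyvaginHeegnerData Dt β ι 1)
    (hy : ¬ IsOfFinAddOrder d₁.derivedPoint)
    {Wd : WeierstrassCurve ℚ} [Wd.IsElliptic] (Cd : VariableChange ℚ) (hCd : Cd • W.quadraticTwist (NumberField.discr K : ℚ) = Wd)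
    (hSel1 : Nat.card (Wd.selmerGroup 2) = 1)
    (P₀ : (W.baseChange K).toAffine.Point)
    (hP₀K : WeierstrassCurve.Affine.Point.map (W' := W) (algebraMap K (ringClassField K ι 1)).toRatAlgHom P₀ = d₁.derivedPoint) :
    (¬ ∃ Q : (W.baseChange (ringClassField K ι 1)).toAffine.Point, (2 : ℤ) • Q = d₁.derivedPoint) ↔
      padicValNat 2 (AddSubgroup.zmultiples P₀).index = 0 := by
  haveI : Fact (Nat.Prime 2) := ⟨Nat.prime_two⟩
  haveI hEK : (W.baseChange K).IsElliptic := isElliptic_baseChange' W K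
  obtain ⟨hPinf, -, hrkK, -, hiv, htor1⟩ := swappedFrame W K hK hodd hH hSel ι d₁ hy Cd hCd hSel1 P₀ hP₀K
  haveI : Finite (AddCommGroup.torsion (W.baseChange K).toAffine.Point) :=
    WeierstrassCurve.finite_torsion_point (W := W.baseChange K)
  obtain ⟨c, Q, hcQ, hcker⟩ := X11b.RankOne.exists_coord_of_mordellWeilRank_eq_one (W.baseChange K) hrkK
  have hcP : c P₀ ≠ 0 := fun h0 ↦ hPinf (hcker P₀ h0)
  -- `2 ∣ P(1)` in `E(K[1])` iff `2 ∣ P₀` in `E(K)`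
  have hdesc : (∃ Q : (W.baseChange (ringClassField K ι 1)).toAffine.Point, (2 : ℤ) • Q = d₁.derivedPoint) ↔
      ∃ R : (W.baseChange K).toAffine.Point, ((2 ^ 1 : ℕ) : ℤ) • R = P₀ := by
    rw [← X11b.Three.Koly.pDiv_one_iff_exists_zsmul_eq hK d₁ P₀ hP₀K 2 1 (htor1 1)]
    simp [X11b.Three.Koly.PDiv]
  -- `2 ∣ P₀` in `E(K)` iff `2 ∣ c(P₀)`
  have key : (∃ R : (W.baseChange K).toAffine.Point, ((2 ^ 1 : ℕ) : ℤ) • R = P₀) ↔ 2 ^ 1 ∣ (c P₀).natAbs := by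
    constructor
    · rintro ⟨R, hR⟩
      have h := congrArg c hR
      rw [map_zsmul, smul_eq_mul] at h
      exact Int.ofNat_dvd_left.mp ⟨c R, by rw [← h]⟩
    · intro hM
      obtain ⟨a, ha⟩ := Int.ofNat_dvd_left.mpr hM
      have ht : IsOfFinAddOrder (P₀ - c P₀ • Q) := X11b.RankOne.isOfFinAddOrder_sub_coord_zsmul c Q hcQ hcker P₀
      obtain ⟨t', ht'⟩ := X11b.LocalIndex.mem_range_nsmul_pow_of_isOfFinAddOrder hiv 1 ht
      refine ⟨a • Q + t', ?_⟩
      have ht'' : (2 ^ 1) • t' = P₀ - c P₀ • Q := by rw [← nsmulAddMonoidHom_apply]; exact ht'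
      rw [smul_add, smul_smul, ← ha, natCast_zsmul, ht'']
      abel
  rw [hdesc, key, X11b.RankOne.padicValNat_index_zmultiples_eq c Q hcQ hcker hiv P₀ hcP, pow_one,
    padicValNat.eq_zero_iff]
  constructor
  · exact fun h ↦ Or.inr (Or.inr h)
  · rintro (h | h | h)
    · exact absurd h (by norm_num)
    · exact absurd h (Int.natAbs_ne_zero.mpr hcP)
    · exact h

/-- **Odd-index form.**  On the same frame: `P(1) ∉ 2E(K[1]) ↔ ¬ 2 ∣ [E(K) : ℤP₀]` (the index is finite and non-zero: `rank E(K) = 1`,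
`P₀` of infinite order).  [cite: McCallumLMS1991, §5 Lemma 5.1 (p. 303)] -/
theorem not_twoDiv_derivedPoint_iff_not_two_dvd_index
    (W : WeierstrassCurve ℚ) [W.IsElliptic] [W.IsGloballyMinimal] [NeZero (W.conductorNorm ℤ)]
    (K : Type) [Field K] [NumberField K] (hK : IsImaginaryQuadratic K) (hodd : Odd (NumberField.discr K))
    (hH : SatisfiesHeegnerHypothesis (W.conductorNorm ℤ) K) (hSel : Nat.card (W.selmerGroup 2) = 2)
    {Dt : ModularParametrizationData W (W.conductorNorm ℤ)} {β : ℤ} (ι : K →+* ℂ) (d₁ : KolyvaginHeegnerData Dt β ι 1)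
    (hy : ¬ IsOfFinAddOrder d₁.derivedPoint)
    {Wd : WeierstrassCurve ℚ} [Wd.IsElliptic] (Cd : VariableChange ℚ) (hCd : Cd • W.quadraticTwist (NumberField.discr K : ℚ) = Wd)
    (hSel1 : Nat.card (Wd.selmerGroup 2) = 1)
    (P₀ : (W.baseChange K).toAffine.Point)
    (hP₀K : WeierstrassCurve.Affine.Point.map (W' := W) (algebraMap K (ringClassField K ι 1)).toRatAlgHom P₀ = d₁.derivedPoint) :
    (¬ ∃ Q : (W.baseChange (ringClassField K ι 1)).toAffine.Point, (2 : ℤ) • Q = d₁.derivedPoint) ↔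
      ¬ 2 ∣ (AddSubgroup.zmultiples P₀).index := by
  haveI : Fact (Nat.Prime 2) := ⟨Nat.prime_two⟩
  haveI hEK : (W.baseChange K).IsElliptic := isElliptic_baseChange' W K
  obtain ⟨hPinf, -, hrkK, -, -, -⟩ := swappedFrame W K hK hodd hH hSel ι d₁ hy Cd hCd hSel1 P₀ hP₀K
  -- the index is non-zero (heights: `#tors² · ĥ(P₀) = I² · Reg`, `ĥ(P₀) ≠ 0`)
  have hI0 : (AddSubgroup.zmultiples P₀).index ≠ 0 := fun hI ↦ by
    have hh := P2.torsionOrder_sq_mul_canonicalHeight_eq_index_sq_mul_regulator (W.baseChange K) hrkK P₀ hPinf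
    rw [hI, Nat.cast_zero, zero_pow two_ne_zero, zero_mul, mul_eq_zero, pow_eq_zero_iff two_ne_zero,
      Nat.cast_eq_zero] at hh
    exact hh.elim (W.baseChange K).torsionOrder_pos_holds.ne'
      (fun h0 ↦ hPinf ((Affine.Point.canonicalHeight_eq_zero_iff_holds P₀).mp h0))
  rw [not_twoDiv_derivedPoint_iff_padicValNat_index_eq_zero W K hK hodd hH hSel ι d₁ hy Cd hCd hSel1 P₀ hP₀K,
    padicValNat.eq_zero_iff]
  constructor
  · rintro (h | h | h)
    · exact absurd h (by norm_num)
    · exact absurd h hI0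
    · exact h
  · exact fun h ↦ Or.inr (Or.inr h)

/-! ## §3 OFF THE ODD-TAMAGAWA SLICE the clause is BSD-inconsistent: `2 ∣ C(E)` forces `2 ∣ y_K` -/

/-- **`2 ∣ C(E)` ⟹ `BSD₂(E) ∧ BSD₂(Wd)` + PRINT force `P(1) ∈ 2E(K[1])`** on the swapped frame (no budget, no Tamagawa parity needed).
`W/ℚ` globally minimal of analytic rank `1`, `#Sel₂(E) = 2`, **`C(E)` EVEN**; `K` imaginary quadratic, `d_K` odd `≠ −3`, Heegner for `N_E`;
`Dt` with odd `Dt.c`; `d₁` conductor-`1` with `P(1)` of infinite order; `Wd` a globally minimal model of `E^(d_K)` with `#Sel₂(Wd) = 1`.  THEN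
`P(1)` is `2`-DIVISIBLE in `E(K[1])`.  Mechanism: the exactness-on-the-canonical-model iff (`.mpr`) turns the two `BSD₂` into
`ord₂ #Ш_an(E_K) = ord₂ #Ш(E_K) ≥ 0`, while Gross–Zagier over `K` reads `ord₂ #Ш_an(E_K) = 2 ord₂ I − 2 ord₂ C(E)` (`w_K = 2`, `c` odd); so
`ord₂ I ≥ ord₂ C(E) ≥ 1`, i.e. `2 ∣ c(P₀)` for a rank-one coordinate, i.e. `P₀ ∈ 2E(K)` (`E(K)_tors` is `2`-divisible), i.e. `P(1) ∈ 2E(K[1])`.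
READING: LINE 23's depth-zero witness (stub S2′) is confined to `C(E)` odd not by the method but BY BSD — on the even-Tamagawa cell the route
consumes (`Δ < 0`, `ord₂ C = 1`, sibling file `…TamagawaSlices`) every reversed supply must be positive-depth (`M₀ ≥ 1`), the `ε = −1` image
of the supply cruxes' `K₄`-type cells; equivalently «S2′ without `Odd C(E)`» is refuted modulo the leaf at every even-`C(E)` frame (§3b).
CONDITIONAL on the two `BSD₂` hypotheses and the four named facts; nothing about BSD is proved here.
[cite: GrossZagier1986, V.§2 (2.2)] [cite: Milne1972ArithmeticAV, §1 Thm. 1] [cite: McCallumLMS1991, §5 Lemma 5.1] [cite: Miller2011LMS, Def. 1.1] -/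
theorem twoDiv_derivedPoint_of_bsdp_of_two_dvd_tamagawa
    (W : WeierstrassCurve ℚ) [W.IsElliptic] [W.IsGloballyMinimal] [NeZero (W.conductorNorm ℤ)]
    (K : Type) [Field K] [NumberField K]
    (hGZ : gross_zagier (W.conductorNorm ℤ) W K) (hGZK : rank_eq_analyticRank_of_analyticRank_le_one)
    (hmod : hasEntireLFunction_rat) (hMilneC : Milne1972.bsdQuotient_baseChange_quadratic_anyModel)
    (hr : W.analyticRank = 1) (hSel : Nat.card (W.selmerGroup 2) = 2) (h2T : 2 ∣ W.tamagawaProduct)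
    (hK : IsImaginaryQuadratic K) (hodd : Odd (NumberField.discr K)) (h3 : NumberField.discr K ≠ -3)
    (hH : SatisfiesHeegnerHypothesis (W.conductorNorm ℤ) K)
    (Dt : ModularParametrizationData W (W.conductorNorm ℤ)) (hc : Odd Dt.c) (β : ℤ) (ι : K →+* ℂ)
    (d₁ : KolyvaginHeegnerData Dt β ι 1) (hy : ¬ IsOfFinAddOrder d₁.derivedPoint)
    (Wd : WeierstrassCurve ℚ) [Wd.IsElliptic] [Wd.IsGloballyMinimal]
    (hWd : ∃ C : VariableChange ℚ, C • W.quadraticTwist (NumberField.discr K : ℚ) = Wd)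
    (hSel1 : Nat.card (Wd.selmerGroup 2) = 1)
    (hBW : BSDp W 2) (hBd : BSDp Wd 2) :
    ∃ Q : (W.baseChange (ringClassField K ι 1)).toAffine.Point, (2 : ℤ) • Q = d₁.derivedPoint := by
  haveI : Fact (Nat.Prime 2) := ⟨Nat.prime_two⟩
  haveI hEK : (W.baseChange K).IsElliptic := isElliptic_baseChange' W K
  have h2 : Module.finrank ℚ K = 2 := hK.1
  have hD0 : (NumberField.discr K : ℚ) ≠ 0 := by exact_mod_cast NumberField.discr_ne_zero K
  haveI hEt : (W.quadraticTwist (NumberField.discr K : ℚ)).IsElliptic := W.isElliptic_quadraticTwist hD0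
  obtain ⟨-, hDlt⟩ := discr_emod_four_and_lt_of_odd hK hodd h3
  have hw2 : Units.torsionOrder K = 2 :=
    Literature.NumberTheory.QuadraticFields.Quadratic.torsionOrder_eq_two_of_discr_lt_neg_four h2 hDlt
  have hc0 : Dt.c ≠ 0 := by
    obtain ⟨k, hk⟩ := hc
    omega
  obtain ⟨Cd, hCd⟩ := hWd
  -- the Heegner point `P₀ ∈ E(K)` below `P(1)`; the frame
  obtain ⟨P₀, Hd, hP₀, hP₀K⟩ := exists_heegnerPoint_map_eq_derivedPoint_one hK hH d₁
  obtain ⟨hPinf, -, hrkK, -, hiv, htor1⟩ := swappedFrame W K hK hodd hH hSel ι d₁ hy Cd hCd hSel1 P₀ hP₀K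
  -- analytic ranks: `r_an(E^(d_K)) = 0`, `r_an(E_K) = 1`
  have hrt : (W.quadraticTwist (NumberField.discr K : ℚ)).analyticRank = 0 :=
    analyticRank_twist_eq_zero_of_rankOne W K hGZ hmod hK hH hr ⟨Dt, Hd, ι, hP₀⟩ hPinf
  have hrd : Wd.analyticRank = 0 := by rw [← hCd, analyticRank_smul, hrt]
  have hrK : (W.baseChange K).analyticRank = 1 :=
    (P2.analyticRank_baseChange_eq_one_iff W K hmod h2).mpr (Or.inl ⟨hr, hrt⟩)
  -- Gross–Zagier over `K`: `#Ш_an(E_K) = 4 I² / (c² w_K² C(E)²)`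
  obtain ⟨-, hShaK, -, hshaC⟩ := shaAnOverC_baseChange_eq_of_heegner W K Dt Hd ι P₀ hGZ hGZK hmod hK hH hP₀ hc0 hrK
  haveI hfinK : Finite (W.baseChange K).sha := hShaK
  -- the two `BSD₂` give `ord₂ #Ш_an(E_K) = ord₂ #Ш(E_K)`
  obtain ⟨q', hq', hv'⟩ :=
    (missingPPartOverCAt_baseChange_iff_bsdp W 2 K Wd hGZK hmod hMilneC (by rw [hr]) h2 ⟨Cd, hCd⟩
      (by rw [hrd]; exact zero_le_one) hBd).mpr hBW
  -- a rank-one coordinate: `ord₂ I = ord₂ |c(P₀)|`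
  haveI : Finite (AddCommGroup.torsion (W.baseChange K).toAffine.Point) :=
    WeierstrassCurve.finite_torsion_point (W := W.baseChange K)
  obtain ⟨c, Q, hcQ, hcker⟩ := X11b.RankOne.exists_coord_of_mordellWeilRank_eq_one (W.baseChange K) hrkK
  have hcP : c P₀ ≠ 0 := fun h0 ↦ hPinf (hcker P₀ h0)
  set I := (AddSubgroup.zmultiples P₀).index with hI_def
  have hIc : padicValNat 2 I = padicValNat 2 (c P₀).natAbs :=
    X11b.RankOne.padicValNat_index_zmultiples_eq c Q hcQ hcker hiv P₀ hcP
  have hI0 : I ≠ 0 := fun hI ↦ by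
    have hh := P2.torsionOrder_sq_mul_canonicalHeight_eq_index_sq_mul_regulator (W.baseChange K) hrkK P₀ hPinf
    rw [← hI_def, hI, Nat.cast_zero, zero_pow two_ne_zero, zero_mul, mul_eq_zero, pow_eq_zero_iff two_ne_zero,
      Nat.cast_eq_zero] at hh
    exact hh.elim (W.baseChange K).torsionOrder_pos_holds.ne'
      (fun h0 ↦ hPinf ((Affine.Point.canonicalHeight_eq_zero_iff_holds P₀).mp h0))
  -- `ord₂ q = 2 ord₂ I − 2 ord₂ C(E)`
  set q : ℚ := 4 * (I : ℚ) ^ 2 /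
      ((Dt.c : ℚ) ^ 2 * (Units.torsionOrder K : ℚ) ^ 2 * ((W.tamagawaProduct : ℚ) ^ 2)) with hq_def
  have hqq : q' = q := Rat.cast_injective (α := ℂ) (hq'.symm.trans hshaC)
  have hcQ0 : (Dt.c : ℚ) ≠ 0 := by exact_mod_cast hc0
  have hC0 : W.tamagawaProduct ≠ 0 := W.tamagawaProduct_pos_holds.ne'
  have hcW0 : (W.tamagawaProduct : ℚ) ≠ 0 := by exact_mod_cast hC0
  have hIQ0 : (I : ℚ) ≠ 0 := by exact_mod_cast hI0
  have hqI : q = ((I : ℚ) / ((Dt.c : ℚ) * (W.tamagawaProduct : ℚ))) ^ 2 := by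
    rw [hq_def, hw2]
    push_cast
    field_simp
    ring
  have hvc : padicValRat 2 (Dt.c : ℚ) = 0 := by
    rw [padicValRat.of_int, padicValInt.eq_zero_of_not_dvd (fun h2c ↦
      (Int.not_even_iff_odd.mpr hc) (even_iff_two_dvd.mpr h2c))]
    rfl
  have hval : padicValRat 2 q = 2 * (padicValNat 2 I : ℤ) - 2 * (padicValNat 2 W.tamagawaProduct : ℤ) := by
    rw [hqI, padicValRat.pow, padicValRat.div hIQ0 (mul_ne_zero hcQ0 hcW0),
      padicValRat.mul hcQ0 hcW0, hvc, padicValRat.of_nat, padicValRat.of_nat]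
    push_cast
    ring
  -- `ord₂ C(E) ≥ 1`, `ord₂ #Ш(E_K) ≥ 0`, hence `ord₂ I ≥ 1`
  have hC1 : 1 ≤ padicValNat 2 W.tamagawaProduct := one_le_padicValNat_of_dvd hC0 h2T
  rw [hqq, hval] at hv'
  have hI1 : 1 ≤ padicValNat 2 (c P₀).natAbs := by
    rw [← hIc]
    have h0 : (0 : ℤ) ≤ (padicValNat 2 (W.baseChange K).shaOrder : ℤ) := by positivity
    omega
  -- `2 ∣ c(P₀)`, so `P₀ ∈ 2E(K)` (the torsion part is `2`-divisible), so `P(1) ∈ 2E(K[1])`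
  have h2c : 2 ^ 1 ∣ (c P₀).natAbs := (padicValNat_dvd_iff_le (Int.natAbs_ne_zero.mpr hcP)).mpr hI1
  obtain ⟨a, ha⟩ := Int.ofNat_dvd_left.mpr h2c
  have ht : IsOfFinAddOrder (P₀ - c P₀ • Q) := X11b.RankOne.isOfFinAddOrder_sub_coord_zsmul c Q hcQ hcker P₀
  obtain ⟨t', ht'⟩ := X11b.LocalIndex.mem_range_nsmul_pow_of_isOfFinAddOrder hiv 1 ht
  have ht'' : (2 ^ 1) • t' = P₀ - c P₀ • Q := by rw [← nsmulAddMonoidHom_apply]; exact ht'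
  have hdivK : ∃ R : (W.baseChange K).toAffine.Point, ((2 ^ 1 : ℕ) : ℤ) • R = P₀ := by
    refine ⟨a • Q + t', ?_⟩
    rw [smul_add, smul_smul, ← ha, natCast_zsmul, ht'']
    abel
  have hP : X11b.Three.Koly.PDiv d₁ 2 1 :=
    (X11b.Three.Koly.pDiv_one_iff_exists_zsmul_eq hK d₁ P₀ hP₀K 2 1 (htor1 1)).mpr hdivK
  simpa [X11b.Three.Koly.PDiv] using hP

/-- **Off the odd-Tamagawa slice the leaf REFUTES the depth-zero witness** (route currency): the leaf `NonCMAtTwo` + the four PRINT items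
⟹ for `W` non-CM of analytic rank `1` with `#Sel₂(E) = 2` and **`2 ∣ C(E)`**, every swapped frame (`K` Heegner, `d_K` odd `≠ −3`; odd-Manin
`Dt`; `P(1)` of infinite order; a globally minimal `2`-Selmer-trivial twin) has `P(1) ∈ 2E(K[1])`.  So «S2′ without `Odd C(E)`» is FALSE
modulo the leaf on every even-`C(E)` curve admitting such a frame, and the even-Tamagawa cell of U₂ the route consumes (`Δ < 0`, `ord₂ C = 1`)
needs a positive-depth mechanism.  CONDITIONAL on the leaf; BSD is NOT proved by this.
[cite: GrossZagier1986, V.§2 (2.2)] [cite: Milne1972ArithmeticAV, §1 Thm. 1] [cite: Miller2011LMS, Def. 1.1] -/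
theorem twoDiv_derivedPoint_of_nonCMAtTwo_of_two_dvd_tamagawa
    (hleaf : NonCMAtTwo) (hGZ : GrossZagierAllLevels) (hL : EntireLFunctionRat) (hGZK : MultPublishedInputsAtTwo) (hMi : MilneAnyModel)
    (W : WeierstrassCurve ℚ) [W.IsElliptic] [W.IsGloballyMinimal] [NeZero (W.conductorNorm ℤ)]
    (hcm : ¬ W.HasCM) (hr : W.analyticRank = 1) (hSel : Nat.card (W.selmerGroup 2) = 2) (h2T : 2 ∣ W.tamagawaProduct)
    (K : Type) [Field K] [NumberField K] (hK : IsImaginaryQuadratic K) (hodd : Odd (NumberField.discr K))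
    (h3 : NumberField.discr K ≠ -3) (hH : SatisfiesHeegnerHypothesis (W.conductorNorm ℤ) K)
    (Dt : ModularParametrizationData W (W.conductorNorm ℤ)) (hc : Odd Dt.c) (β : ℤ) (ι : K →+* ℂ)
    (d₁ : KolyvaginHeegnerData Dt β ι 1) (hy : ¬ IsOfFinAddOrder d₁.derivedPoint)
    (Wd : WeierstrassCurve ℚ) [Wd.IsElliptic] [Wd.IsGloballyMinimal]
    (hWd : ∃ C : VariableChange ℚ, C • W.quadraticTwist (NumberField.discr K : ℚ) = Wd)
    (hSel1 : Nat.card (Wd.selmerGroup 2) = 1) :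
    ∃ Q : (W.baseChange (ringClassField K ι 1)).toAffine.Point, (2 : ℤ) • Q = d₁.derivedPoint := by
  haveI hEK : (W.baseChange K).IsElliptic := isElliptic_baseChange' W K
  have hD0 : (NumberField.discr K : ℚ) ≠ 0 := by exact_mod_cast NumberField.discr_ne_zero K
  haveI hEt : (W.quadraticTwist (NumberField.discr K : ℚ)).IsElliptic := W.isElliptic_quadraticTwist hD0
  obtain ⟨Cd, hCd⟩ := hWd
  have hBW : BSDp W 2 := hleaf W hcm (by rw [hr])
  have hcmd : ¬ Wd.HasCM := by
    rw [← hCd, hasCM_iff_of_j_eq (((W.quadraticTwist (NumberField.discr K : ℚ)).variableChange_j Cd).trans (W.j_quadraticTwist hD0))]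
    exact hcm
  obtain ⟨P₀, Hd, hP₀, hP₀K⟩ := exists_heegnerPoint_map_eq_derivedPoint_one hK hH d₁
  obtain ⟨hPinf, -, -, -, -, -⟩ := swappedFrame W K hK hodd hH hSel ι d₁ hy Cd hCd hSel1 P₀ hP₀K
  have hrt : (W.quadraticTwist (NumberField.discr K : ℚ)).analyticRank = 0 :=
    analyticRank_twist_eq_zero_of_rankOne W K (hGZ _ W K) hL hK hH hr ⟨Dt, Hd, ι, hP₀⟩ hPinf
  have hrd : Wd.analyticRank = 0 := by rw [← hCd, analyticRank_smul, hrt]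
  have hBd : BSDp Wd 2 := hleaf Wd hcmd (by rw [hrd]; exact zero_le_one)
  exact twoDiv_derivedPoint_of_bsdp_of_two_dvd_tamagawa W K (hGZ _ W K) hGZK hL hMi hr hSel h2T hK hodd h3 hH Dt hc β ι d₁ hy Wd
    ⟨Cd, hCd⟩ hSel1 hBW hBd

end Summit.BirchSwinnertonDyer.BirchSwinnertonDyer.Theorems.GenusExact.TwinSwap.HeegnerIndex

end
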